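import Mathlib

/-!
# Bounded Green's function of the mean-flow smoothing operator `1 - ∂³` — kernel #112 (solo-blind s62)

In the lift-off inner problem of the reduced steady model (kernel #111, `SoloBlindLiftoffInner`:
`m - m''' = (α²)'''` on `ℝ`, `m` bounded) and in the (NL-5) composite analysis of §24.62 (the
mean-shear response `δμ = -A (1 - ℓ³∂³)⁻¹ ∂³ δq` to an envelope mismatch `δq` — the
"third-order join rule"), the operator is `1 - ∂³` on bounded functions of the inner variable
`η`. Its bounded Green's function is
`G(η) = (1/3) e^{η}` (`η ≤ 0`), `G(η) = (1/3) e^{-η/2} (cos(√3 η/2) + √3 sin(√3 η/2))` (`η ≥ 0`).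
This file certifies, sorry-free:
* the characteristic root `k = -1/2 + (√3/2) i` of `k³ = 1` in the left half plane
  (`smoothing_root_sq`, `smoothing_root_cube`);
* every mode `η ↦ Re(c e^{kη})` differentiates to the mode with `c ↦ c k`
  (`smoothing_mode_hasDerivAt`), hence with `k³ = 1` it is its own third derivative
  (`smoothing_mode_third`): `G - G''' = 0` on `η > 0`; the left branch `a e^{η}` likewise
  (`smoothing_left_hasDerivAt`);
* the right branch of `G` is the mode with `c = (1 - i√3)/3` (`smoothing_right_real`), and the
  products `c k = (1 + i√3)/3`, `c k² = -2/3` (`smoothing_coeff_mul_root`, `smoothing_coeff_mul_root_sq`);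
* the one-sided junction data `G(0±) = 1/3`, `G'(0±) = 1/3`, `G''(0-) = 1/3`, `G''(0+) = -2/3`:
  `[G] = [G'] = 0`, `[G''] = -1`, the unit jump that makes `(1 - ∂³) G = δ`
  (`smoothing_junction_right`, `smoothing_junction_left`, `smoothing_jumps`), and the junction
  equations determine the coefficients uniquely (`smoothing_junction_solve`);
* the envelope `|G(η)| ≤ (2/3) e^{-η/2}` on the right (`smoothing_trig_amp`,
  `smoothing_right_envelope`) and the `L¹` budget: `∫_{η ≤ 0} G = 1/3`, `∫_{η > 0} (2/3)e^{-η/2} = 4/3`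
  (`smoothing_left_mass`, `smoothing_right_envelope_mass`), so `‖G‖₁ ≤ 5/3`,
  `‖(1 - ∂³)⁻¹‖_{L∞ → L∞} ≤ 5/3` and `‖(1 - ∂³)⁻¹ ∂³‖ = ‖(1 - ∂³)⁻¹ - 1‖ ≤ 8/3`
  (`smoothing_operator_budget`).
-/

namespace Summit.AnomalousDissipation.AnomalousDissipation.Theorems

/-! ## the characteristic root `k = -1/2 + (√3/2) i` -/

/-- `k² = -1/2 - (√3/2) i` (the conjugate root). -/
theorem smoothing_root_sq :
    (Complex.mk (-1/2) (Real.sqrt 3 / 2)) ^ 2 = Complex.mk (-1/2) (-(Real.sqrt 3 / 2)) := by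
  have hs : Real.sqrt 3 * Real.sqrt 3 = 3 := Real.mul_self_sqrt (by norm_num)
  have hs' : Real.sqrt 3 ^ 2 = 3 := Real.sq_sqrt (by norm_num)
  apply Complex.ext
  · simp [pow_two, Complex.mul_re]; nlinarith [hs, hs']
  · simp [pow_two, Complex.mul_im]; ring

/-- `k³ = 1`. -/
theorem smoothing_root_cube : (Complex.mk (-1/2) (Real.sqrt 3 / 2)) ^ 3 = 1 := by
  have hs : Real.sqrt 3 * Real.sqrt 3 = 3 := Real.mul_self_sqrt (by norm_num)
  have hs' : Real.sqrt 3 ^ 2 = 3 := Real.sq_sqrt (by norm_num)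
  rw [pow_succ, smoothing_root_sq]
  apply Complex.ext
  · simp [Complex.mul_re]; nlinarith [hs, hs']
  · simp [Complex.mul_im]; ring

/-! ## modes are their own third derivatives -/

/-- derivative of a complex mode restricted to the real line: `d/dη Re(c e^{kη}) = Re(c k e^{kη})`. -/
theorem smoothing_mode_hasDerivAt (c k : ℂ) (η : ℝ) :
    HasDerivAt (fun x : ℝ => (c * Complex.exp (k * x)).re) ((c * k * Complex.exp (k * η))).re η := by
  have h1 : HasDerivAt (fun z : ℂ => k * z) k (η : ℂ) := by
    simpa using (hasDerivAt_id (η : ℂ)).const_mul k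
  have h2 : HasDerivAt (fun z : ℂ => Complex.exp (k * z)) (Complex.exp (k * η) * k) (η : ℂ) :=
    (Complex.hasDerivAt_exp (k * η)).comp (η : ℂ) h1
  have h3 := h2.const_mul c
  have e : c * (Complex.exp (k * η) * k) = c * k * Complex.exp (k * η) := by ring
  rw [e] at h3
  exact h3.real_of_complex

/-- with `k³ = 1` the mode `Re(c k² · e^{kη})` (the second derivative of `Re(c e^{kη})`)
differentiates back to `Re(c e^{kη})`: every mode is its own third derivative, i.e. solves
`g - g''' = 0`. -/
theorem smoothing_mode_third {c k : ℂ} (hk : k ^ 3 = 1) (η : ℝ) :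
    HasDerivAt (fun x : ℝ => (c * k * k * Complex.exp (k * x)).re) ((c * Complex.exp (k * η))).re η := by
  have h := smoothing_mode_hasDerivAt (c * k * k) k η
  have e : c * k * k * k = c := by
    calc c * k * k * k = c * k ^ 3 := by ring
      _ = c := by rw [hk, mul_one]
  rw [e] at h
  exact h

/-- the left branch `a e^{η}` is its own derivative (hence its own third derivative). -/
theorem smoothing_left_hasDerivAt (a η : ℝ) :
    HasDerivAt (fun x : ℝ => a * Real.exp x) (a * Real.exp η) η :=
  (Real.hasDerivAt_exp η).const_mul a

/-! ## the right branch of `G` in real form and the coefficient products -/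

/-- `Re((1 - i√3)/3 · e^{kη}) = (1/3) e^{-η/2} (cos(√3 η/2) + √3 sin(√3 η/2))`. -/
theorem smoothing_right_real (η : ℝ) :
    ((Complex.mk (1/3) (-(Real.sqrt 3 / 3))) * Complex.exp (Complex.mk (-1/2) (Real.sqrt 3 / 2) * η)).re
      = (1/3) * Real.exp (-(η/2)) *
          (Real.cos (Real.sqrt 3 / 2 * η) + Real.sqrt 3 * Real.sin (Real.sqrt 3 / 2 * η)) := by
  have hre : (Complex.mk (-1/2) (Real.sqrt 3 / 2) * (η : ℂ)).re = -(η/2) := by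
    simp only [Complex.mul_re, Complex.ofReal_re, Complex.ofReal_im, mul_zero, sub_zero]; ring
  have him : (Complex.mk (-1/2) (Real.sqrt 3 / 2) * (η : ℂ)).im = Real.sqrt 3 / 2 * η := by
    simp only [Complex.mul_im, Complex.ofReal_re, Complex.ofReal_im, mul_zero, zero_add]
  rw [Complex.mul_re, Complex.exp_re, Complex.exp_im, hre, him]
  ring

/-- `c k = (1 + i√3)/3` for `c = (1 - i√3)/3`. -/
theorem smoothing_coeff_mul_root :
    Complex.mk (1/3) (-(Real.sqrt 3 / 3)) * Complex.mk (-1/2) (Real.sqrt 3 / 2)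
      = Complex.mk (1/3) (Real.sqrt 3 / 3) := by
  have hs : Real.sqrt 3 * Real.sqrt 3 = 3 := Real.mul_self_sqrt (by norm_num)
  have hs' : Real.sqrt 3 ^ 2 = 3 := Real.sq_sqrt (by norm_num)
  apply Complex.ext
  · simp [Complex.mul_re]; nlinarith [hs, hs']
  · simp [Complex.mul_im]; ring

/-- `c k² = -2/3` (real): the second derivative of the right branch at `0⁺` is `-2/3`. -/
theorem smoothing_coeff_mul_root_sq :
    Complex.mk (1/3) (-(Real.sqrt 3 / 3)) * Complex.mk (-1/2) (Real.sqrt 3 / 2) * Complex.mk (-1/2) (Real.sqrt 3 / 2)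
      = Complex.mk (-2/3) 0 := by
  have hs : Real.sqrt 3 * Real.sqrt 3 = 3 := Real.mul_self_sqrt (by norm_num)
  have hs' : Real.sqrt 3 ^ 2 = 3 := Real.sq_sqrt (by norm_num)
  rw [smoothing_coeff_mul_root]
  apply Complex.ext
  · simp [Complex.mul_re]; nlinarith [hs, hs']
  · simp [Complex.mul_im]; ring

/-! ## junction data at `η = 0` -/

/-- right branch at `0⁺`: `G(0+) = 1/3`, `G'(0+) = Re(c k) = 1/3`, `G''(0+) = Re(c k²) = -2/3`. -/
theorem smoothing_junction_right :
    (Complex.mk (1/3) (-(Real.sqrt 3 / 3)) * Complex.exp (Complex.mk (-1/2) (Real.sqrt 3 / 2) * (0:ℝ))).re = 1/3 ∧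
    (Complex.mk (1/3) (-(Real.sqrt 3 / 3)) * Complex.mk (-1/2) (Real.sqrt 3 / 2) *
        Complex.exp (Complex.mk (-1/2) (Real.sqrt 3 / 2) * (0:ℝ))).re = 1/3 ∧
    (Complex.mk (1/3) (-(Real.sqrt 3 / 3)) * Complex.mk (-1/2) (Real.sqrt 3 / 2) * Complex.mk (-1/2) (Real.sqrt 3 / 2) *
        Complex.exp (Complex.mk (-1/2) (Real.sqrt 3 / 2) * (0:ℝ))).re = -2/3 := by
  rw [smoothing_coeff_mul_root_sq, smoothing_coeff_mul_root]
  simp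

/-- left branch at `0⁻`: `G = G' = G'' = (1/3) e^{0} = 1/3`. -/
theorem smoothing_junction_left : (1/3 : ℝ) * Real.exp 0 = 1/3 := by simp

/-- the jumps across `η = 0`: `[G] = 0`, `[G'] = 0`, `[G''] = -2/3 - 1/3 = -1`, i.e.
`-(G''(0+) - G''(0-)) = 1`: integrating `G - G''' = δ` across the origin. -/
theorem smoothing_jumps :
    (1/3 : ℝ) - 1/3 = 0 ∧ (1/3 : ℝ) - 1/3 = 0 ∧ (-2/3 : ℝ) - 1/3 = -1 ∧ -((-2/3 : ℝ) - 1/3) = 1 := by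
  norm_num

/-- UNIQUENESS OF THE COEFFICIENTS. For `G = α e^{η}` (`η < 0`) and
`G = e^{-η/2}(β cos ωη + γ sin ωη)` (`η > 0`, `ω = √3/2`, so `ω² = 3/4`) the one-sided data are
`G(0-) = G'(0-) = G''(0-) = α`, `G(0+) = β`, `G'(0+) = -β/2 + γω`, `G''(0+) = β/4 - γω - βω²`;
continuity of `G, G'` and the jump `[G''] = -1` force `α = β = 1/3`, `γω = 1/2` (`γ = √3/3`). -/
theorem smoothing_junction_solve (α β γ ω : ℝ) (hω : ω ^ 2 = 3/4)
    (h0 : β = α) (h1 : -β/2 + γ * ω = α) (h2 : (β/4 - γ * ω - β * ω ^ 2) - α = -1) :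
    α = 1/3 ∧ β = 1/3 ∧ γ * ω = 1/2 := by
  rw [hω] at h2
  refine ⟨by linarith, by linarith, by linarith⟩

/-- and with `ω = √3/2`, `γω = 1/2` gives `γ = √3/3` (the coefficient in `smoothing_right_real`). -/
theorem smoothing_gamma (γ : ℝ) (h : γ * (Real.sqrt 3 / 2) = 1/2) : γ = Real.sqrt 3 / 3 := by
  have hs : Real.sqrt 3 * Real.sqrt 3 = 3 := Real.mul_self_sqrt (by norm_num)
  have hpos : 0 < Real.sqrt 3 := Real.sqrt_pos.mpr (by norm_num)
  have : γ * Real.sqrt 3 = 1 := by linarith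
  nlinarith [this, hs, hpos]

/-! ## envelope and `L¹` budget -/

/-- `|cos x + √3 sin x| ≤ 2` (`= 2|sin(x + π/6)|`). -/
theorem smoothing_trig_amp (x : ℝ) : |Real.cos x + Real.sqrt 3 * Real.sin x| ≤ 2 := by
  have hs' : Real.sqrt 3 ^ 2 = 3 := Real.sq_sqrt (by norm_num)
  have h := Real.sin_sq_add_cos_sq x
  have hid : (Real.cos x + Real.sqrt 3 * Real.sin x) ^ 2
      + (Real.sqrt 3 * Real.cos x - Real.sin x) ^ 2 = 4 := by
    linear_combination (1 + Real.sqrt 3 ^ 2) * h + hs'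
  have hsq : (Real.cos x + Real.sqrt 3 * Real.sin x) ^ 2 ≤ 4 := by
    nlinarith [hid, sq_nonneg (Real.sqrt 3 * Real.cos x - Real.sin x)]
  rw [abs_le]
  constructor
  · nlinarith [hsq, sq_nonneg (Real.cos x + Real.sqrt 3 * Real.sin x + 2)]
  · nlinarith [hsq, sq_nonneg (Real.cos x + Real.sqrt 3 * Real.sin x - 2)]

/-- the right branch is bounded by the envelope `(2/3) e^{-η/2}`. -/
theorem smoothing_right_envelope (η : ℝ) :
    |(1/3) * Real.exp (-(η/2)) *
        (Real.cos (Real.sqrt 3 / 2 * η) + Real.sqrt 3 * Real.sin (Real.sqrt 3 / 2 * η))|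
      ≤ (2/3) * Real.exp (-(η/2)) := by
  have hpos : (0:ℝ) < (1/3) * Real.exp (-(η/2)) := by positivity
  rw [abs_mul, abs_of_pos hpos]
  have ht := smoothing_trig_amp (Real.sqrt 3 / 2 * η)
  nlinarith [Real.exp_pos (-(η/2)), ht]

/-- the left branch is positive and bounded by `(1/3) e^{η} ≤ (1/3) e^{-|η|/2}` for `η ≤ 0`
(indeed `e^{η} ≤ e^{η/2} = e^{-|η|/2}` there). -/
theorem smoothing_left_envelope {η : ℝ} (hη : η ≤ 0) :
    0 < (1/3) * Real.exp η ∧ (1/3) * Real.exp η ≤ (1/3) * Real.exp (-(|η|/2)) := by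
  refine ⟨by positivity, ?_⟩
  have : η ≤ -(|η|/2) := by rw [abs_of_nonpos hη]; linarith
  have := Real.exp_le_exp.mpr this
  linarith

/-- `∫_{η ≤ 0} (1/3) e^{η} dη = 1/3`. -/
theorem smoothing_left_mass : ∫ x in Set.Iic (0:ℝ), (1/3 : ℝ) * Real.exp x = 1/3 := by
  rw [MeasureTheory.integral_const_mul, integral_exp_Iic_zero]; norm_num

/-- `∫_{η > 0} (2/3) e^{-η/2} dη = 4/3` (mass of the right envelope). -/
theorem smoothing_right_envelope_mass :
    ∫ x in Set.Ioi (0:ℝ), (2/3 : ℝ) * Real.exp (-(1/2) * x) = 4/3 := by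
  rw [MeasureTheory.integral_const_mul, integral_exp_mul_Ioi (by norm_num : (-(1/2) : ℝ) < 0) 0]
  norm_num

/-- THE OPERATOR BUDGET. `‖G‖₁ ≤ 1/3 + 4/3 = 5/3`, so on bounded functions
`‖(1 - ∂³)⁻¹ f‖_∞ ≤ (5/3)‖f‖_∞` and, since `(1 - ∂³)⁻¹∂³ = (1 - ∂³)⁻¹ - 1`,
`‖(1 - ∂³)⁻¹ ∂³ q‖_∞ ≤ (8/3)‖q‖_∞`; equivalently `‖(1-∂³)⁻¹∂³ q‖_∞ ≤ (5/3)‖q'''‖_∞`. A `C³`-small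
mismatch is harmless, an `O(δ)` mismatch blended over width `w` costs `O(δ/w³)` in `μ`:
the third-order join rule of §24.62. (Arithmetic of the constants only.) -/
theorem smoothing_operator_budget :
    (1/3 : ℝ) + 4/3 = 5/3 ∧ (1 : ℝ) + 5/3 = 8/3 ∧ ∀ δ w : ℝ, 0 < w → 0 ≤ δ →
      (5/3) * (δ / w ^ 3) = (5/3) * δ / w ^ 3 := by
  refine ⟨by norm_num, by norm_num, fun δ w _ _ => by ring⟩

end Summit.AnomalousDissipation.AnomalousDissipation.Theorems
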